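import Summits.PneNP.PneNP.Theorems.ReslinSizeFromWidthTreeLike
import Literature.Computability.MetaComplexity.BinaryPigeonholeResLinRank

/-!
# PneNP / ReslinSizeFromWidth — the binary pigeonhole principle on the Res(⊕) ladder

Route `PneNP/ReslinSizeFromWidth`, crux X1 = `ResLinSizeFromWidth` (stmt-PneNP-18932, open; NOT claimed).
The rank input for `BPHPᵐ_{2^ℓ}` — every Res(⊕) refutation has a line of rank `> 2^(ℓ-2) = n/4`
(Efremenko–Garlík–Itsykson 2024 Thm 5.5, tree `Literature.Computability.MetaComplexity.lt_resLinWidth_bphp`,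
reproduced by the gen-7 rung seat) — fed into the ladder laws under the crux:

* `bphp_treeLike_size` — every TREE-LIKE Res(⊕) refutation of `bphpCNF m ℓ` (`ℓ ≥ 3`) has at least
  `2^(2^(ℓ-2) - 2ℓ)` lines (gen-3 law `ResLinSW.pow_le_length_of_treeLike` with `k = 2^(ℓ-2) + 1`,
  clause width `t = 2ℓ`). In print: `2^(2^(ℓ-2))`-type bounds — EGI24 Thm 5.8 gives tree-like size
  `≥ 2^{2^{ℓ-2}}` directly by a Prover–Delayer game; ours loses the additive `2ℓ` of the law.
* `bphp_B_le_length` — every dag-like Res(⊕) refutation has at least `B (2ℓ) (2^(ℓ-2))` lines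
  (gen-2 quadratic law; trivial against the formula size, recorded for uniformity only).

Honest label: one-line compositions; nothing on regular / bounded-depth Res(⊕) size (EGI24 Thm 8.1,
Byramji–Impagliazzo 2025), which is the real content of the BPHP literature.
-/

namespace Summit.PneNP.PneNP.Theorems

-- `Summit.PneNP.PneNP` repeats a path component by design (summit = sub-problem); silence the linter.
set_option linter.dupNamespace false

open Literature.Computability.Complexity Literature.Computability.MetaComplexity

/-- **Tree-like Res(⊕) size of `BPHP`** via the ladder: for `ℓ ≥ 3` and every `m`, every tree-like
Res(⊕) refutation (each line used as a premise at most once) of `bphpCNF m ℓ` has at least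
`2^(2^(ℓ-2) - 2ℓ)` lines. (EGI24 Thm 5.8 proves `2^{2^{ℓ-2}}` directly.) -/
theorem bphp_treeLike_size {ℓ : ℕ} (hℓ : 3 ≤ ℓ) (m : ℕ) {π : List ResLinLine}
    (hπ : IsResLinRefutation (bphpCNF m ℓ) π)
    (htree : ∀ i : ℕ, (π.map fun l => l.premises.count i).sum ≤ 1) :
    2 ^ (2 ^ (ℓ - 2) - 2 * ℓ) ≤ π.length := by
  have h := ResLinSW.pow_le_length_of_treeLike (isWidthLE_bphpCNF m ℓ)
    (fun π' hπ' => (lt_resLinWidth_bphp hℓ m hπ' : 2 ^ (ℓ - 2) + 1 ≤ resLinWidth π')) hπ htree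
  have hexp : 2 ^ (ℓ - 2) + 1 - 2 * ℓ - 1 = 2 ^ (ℓ - 2) - 2 * ℓ := by omega
  rw [hexp] at h
  exact h

/-- Dag-like Res(⊕) refutations of `bphpCNF m ℓ` (`ℓ ≥ 3`) have at least `B (2ℓ) (2^(ℓ-2))` lines
(gen-2 quadratic law on the rank input; recorded for uniformity — it is below the formula size). -/
theorem bphp_B_le_length {ℓ : ℕ} (hℓ : 3 ≤ ℓ) (m : ℕ) {π : List ResLinLine}
    (hπ : IsResLinRefutation (bphpCNF m ℓ) π) : ResLinSW.B (2 * ℓ) (2 ^ (ℓ - 2)) ≤ π.length := by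
  have h := ResLinSW.B_le_length_of_isResLinRefutation (isWidthLE_bphpCNF m ℓ)
    (fun π' hπ' => (lt_resLinWidth_bphp hℓ m hπ' : 2 ^ (ℓ - 2) + 1 ≤ resLinWidth π')) hπ
  simpa using h

end Summit.PneNP.PneNP.Theorems
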